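import Summits.ResolutionOfSingularities.ResolutionOfSingularities.Theorems.WildQuotientsSummitReductionStubPairQuasiSplitBaseChangeLevels
import HarnessLib

/-!
# `WildQuotients.SummitReduction` (stmt-ResolutionOfSingularities-16324), line `FramePerfect`:
# the completed base change of an ordinary double point along a field extension — algebra of stub `stub_pair_quasiSplitBaseChange`

Route `ResolutionOfSingularities/WildQuotients`, crux `SummitReduction`; second helper file of stub
`stub_pair_quasiSplitBaseChange` (quasi-splitness of a semi-stable curve is stable under base change)
of the line skeleton `Cruxes/SummitReduction/Lines/FramePerfect.lean` (v7). De Jong 1997, p. 614–615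
("quasi-split": the singular points of the fibres are rational with rational tangents, which is
obviously stable under extension of the residue field) in commutative algebra, hypothesis-free:

* `exists_levelBijective_into_nodeQuot` — if a Noetherian `κ`-algebra `B` has `𝔫`-adic completion
  `e : B^ ≅ κ⟦u,v⟧/(uv)` over `κ` (`𝔫` maximal), then `B → κ⟦u,v⟧/(uv) ← κ[u,v]/(uv)` are `κ`-algebra
  maps with bijective levels onto the powers of one ideal (Stacks 05GG for `B → B^` and
  `κ[u,v]/(uv) → (κ[u,v]/(uv))^`, the latter `≅ κ⟦u,v⟧/(uv)` by `exists_completion_algebraicNodeRing_equiv`);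
* `exists_completion_tensor_equiv_nodeQuot` (entry theorem, registered sub-goal stub) — **then
  `κ' ⊗_κ B` has `𝔫(κ' ⊗_κ B)`-adic completion `κ'⟦u,v⟧/(uv)`, compatibly with `κ'`**: base change
  preserves level-bijectivity (`levelBijective_lTensor`), so
  `(κ' ⊗_κ B)^ ≅ (κ' ⊗_κ κ⟦u,v⟧/(uv))^ ≅ (κ' ⊗_κ κ[u,v]/(uv))^ = (κ'[u,v]/(uv))^ = κ'⟦u,v⟧/(uv)`;
* `isMaximal_map_tensorInr_of_completion_equiv` — and `𝔫(κ' ⊗_κ B)` is maximal (level one: its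
  residue ring is `κ'`; the point is rational, so exactly one point of the base-changed fibre lies
  over it).
-/

set_option linter.dupNamespace false

noncomputable section

open TensorProduct AdicCompletion
open Literature.AlgebraicGeometry.Resolution

namespace Summit.ResolutionOfSingularities.ResolutionOfSingularities.Theorems

universe u

/-! ## The completed base change of the ordinary double point -/

section Main

open DeJong1996 DeJong1996.AlgebraicNodeRing

variable {κ : Type u} [Field κ] (κ' : Type u) [Field κ'] [Algebra κ κ']
  {B : Type u} [CommRing B] [Algebra κ B] [IsNoetherianRing B] (𝔫 : Ideal B) [h𝔫 : 𝔫.IsMaximal]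
  (e : AdicCompletion 𝔫 B ≃+*
    MvPowerSeries (Fin 2) κ ⧸ Ideal.span {(MvPowerSeries.X 0 * MvPowerSeries.X 1 : MvPowerSeries (Fin 2) κ)})
  (he : ∀ c : κ, e (algebraMap κ (AdicCompletion 𝔫 B) c) = algebraMap κ _ c)

include he in
/-- **`B` and `κ[u,v]/(uv)` map level-bijectively, over `κ`, into `B^ ≅ κ⟦u,v⟧/(uv)`**: the maps
`B → B^ ≅ κ⟦u,v⟧/(uv)` and `κ[u,v]/(uv) → (κ[u,v]/(uv))^ ≅ κ⟦u,v⟧/(uv)` (Stacks 05GG) are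
`κ`-algebra maps with bijective levels onto the levels of the maximal ideal of the local ring
`κ⟦u,v⟧/(uv)`. [folklore] -/
theorem exists_levelBijective_into_nodeQuot :
    ∃ (g₁ : B →ₐ[κ] MvPowerSeries (Fin 2) κ ⧸
          Ideal.span {(MvPowerSeries.X 0 * MvPowerSeries.X 1 : MvPowerSeries (Fin 2) κ)})
      (g₂ : AlgebraicNodeRing κ (0 : κ) →ₐ[κ] MvPowerSeries (Fin 2) κ ⧸
          Ideal.span {(MvPowerSeries.X 0 * MvPowerSeries.X 1 : MvPowerSeries (Fin 2) κ)})
      (𝔪 : Ideal (MvPowerSeries (Fin 2) κ ⧸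
          Ideal.span {(MvPowerSeries.X 0 * MvPowerSeries.X 1 : MvPowerSeries (Fin 2) κ)}))
      (h₁ : 𝔫.map g₁.toRingHom ≤ 𝔪) (h₂ : (nodeOrigin κ).map g₂.toRingHom ≤ 𝔪),
      (∀ n, Function.Bijective (Ideal.quotientMap (𝔪 ^ n) g₁.toRingHom
        (pow_le_comap_pow_of_map_le g₁.toRingHom h₁ n))) ∧
      (∀ n, Function.Bijective (Ideal.quotientMap (𝔪 ^ n) g₂.toRingHom
        (pow_le_comap_pow_of_map_le g₂.toRingHom h₂ n))) ∧
      (∀ b, g₁ b = e (algebraMap B (AdicCompletion 𝔫 B) b)) ∧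
      (∀ p, g₂ (AlgebraicNodeRing.mk κ 0 p) = Ideal.Quotient.mk _ (p : MvPowerSeries (Fin 2) κ)) := by
  set R := MvPowerSeries (Fin 2) κ ⧸
    Ideal.span {(MvPowerSeries.X 0 * MvPowerSeries.X 1 : MvPowerSeries (Fin 2) κ)} with hR
  have h𝔫fg : 𝔫.FG := (isNoetherianRing_iff_ideal_fg B).mp inferInstance 𝔫
  -- `B^` is local, hence so is `R ≅ B^`
  haveI : (𝔫.map (algebraMap B (AdicCompletion 𝔫 B))).IsMaximal :=
    AdicCompletion.isMaximal_map_of_le 𝔫 𝔫 le_rfl h𝔫fg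
  haveI : IsAdicComplete (𝔫.map (algebraMap B (AdicCompletion 𝔫 B))) (AdicCompletion 𝔫 B) :=
    AdicCompletion.isAdicComplete_self 𝔫 h𝔫fg
  haveI : IsLocalRing (AdicCompletion 𝔫 B) :=
    isLocalRing_of_isAdicComplete_maximal (𝔫.map (algebraMap B (AdicCompletion 𝔫 B)))
  haveI : Nontrivial R := e.symm.toEquiv.nontrivial
  haveI hRloc : IsLocalRing R := IsLocalRing.of_surjective' e.toRingHom e.surjective
  -- `g₁ = e ∘ (B → B^)`
  have hb₁ : ∀ n, Function.Bijective (Ideal.quotientMap ((𝔫.map (algebraMap B (AdicCompletion 𝔫 B))) ^ n)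
      (algebraMap B (AdicCompletion 𝔫 B)) (pow_le_comap_pow_of_map_le _ le_rfl n)) := fun n =>
    (bijective_quotientMap_congr (Ideal.map_pow _ 𝔫 n) (algebraMap B (AdicCompletion 𝔫 B)) rfl
      Ideal.le_comap_map (pow_le_comap_pow_of_map_le _ le_rfl n)).mp
      (quotientMap_pow_bijective_adicCompletion 𝔫 h𝔫fg n)
  have hI₁ : (𝔫.map (algebraMap B (AdicCompletion 𝔫 B))).map e.toRingHom = IsLocalRing.maximalIdeal R :=
    IsLocalRing.eq_maximalIdeal (Ideal.IsMaximal.map_bijective e.toRingHom e.bijective inferInstance)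
  obtain ⟨h₁, hb₁'⟩ := levelBijective_comp_ringEquiv 𝔫 _ (algebraMap B (AdicCompletion 𝔫 B)) le_rfl hb₁
    e (IsLocalRing.maximalIdeal R) hI₁
  let g₁ : B →ₐ[κ] R :=
    { e.toRingHom.comp (algebraMap B (AdicCompletion 𝔫 B)) with
      commutes' := fun c => by
        simp only [RingHom.toMonoidHom_eq_coe, OneHom.toFun_eq_coe, MonoidHom.toOneHom_coe,
          MonoidHom.coe_coe, RingHom.coe_comp, RingEquiv.toRingHom_eq_coe, RingHom.coe_coe,
          Function.comp_apply]
        rw [← IsScalarTower.algebraMap_apply, he] }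
  -- `g₂ = ν ∘ (N → N^)`
  obtain ⟨ν, hν⟩ := exists_completion_algebraicNodeRing_equiv κ
  have hNfg : (nodeOrigin κ).FG := (isNoetherianRing_iff_ideal_fg _).mp inferInstance _
  set N : Type u := AlgebraicNodeRing κ (0 : κ) with hN
  set jN : N →+* AdicCompletion (nodeOrigin κ) N := algebraMap N (AdicCompletion (nodeOrigin κ) N) with hjN
  have hb₂ : ∀ n, Function.Bijective (Ideal.quotientMap (((nodeOrigin κ).map jN) ^ n) jN
      (pow_le_comap_pow_of_map_le jN le_rfl n)) := fun n =>
    (bijective_quotientMap_congr (Ideal.map_pow jN (nodeOrigin κ) n) jN rfl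
      Ideal.le_comap_map (pow_le_comap_pow_of_map_le jN le_rfl n)).mp
      (quotientMap_pow_bijective_adicCompletion (nodeOrigin κ) hNfg n)
  haveI : ((nodeOrigin κ).map jN).IsMaximal := AdicCompletion.isMaximal_map_of_le _ _ le_rfl hNfg
  have hI₂ : ((nodeOrigin κ).map jN).map ν.toRingHom = IsLocalRing.maximalIdeal R :=
    IsLocalRing.eq_maximalIdeal (Ideal.IsMaximal.map_bijective ν.toRingHom ν.bijective inferInstance)
  obtain ⟨h₂, hb₂'⟩ := levelBijective_comp_ringEquiv (nodeOrigin κ) _ jN le_rfl hb₂ ν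
    (IsLocalRing.maximalIdeal R) hI₂
  let g₂ : N →ₐ[κ] R :=
    { ν.toRingHom.comp jN with
      commutes' := fun c => by
        simp only [RingHom.toMonoidHom_eq_coe, OneHom.toFun_eq_coe, MonoidHom.toOneHom_coe,
          MonoidHom.coe_coe, RingHom.coe_comp, RingEquiv.toRingHom_eq_coe, RingHom.coe_coe,
          Function.comp_apply]
        change ν (jN (algebraMap κ (AlgebraicNodeRing κ (0 : κ)) c)) = algebraMap κ R c
        rw [AlgebraicNodeRing.algebraMap_eq, ← AlgebraicNodeRing.mk_apply]
        erw [hν]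
        rw [MvPolynomial.coe_C]
        change _ = algebraMap κ (MvPowerSeries (Fin 2) κ ⧸
          Ideal.span {(MvPowerSeries.X 0 * MvPowerSeries.X 1 : MvPowerSeries (Fin 2) κ)}) c
        rw [← Ideal.Quotient.mk_algebraMap, MvPowerSeries.algebraMap_apply, Algebra.algebraMap_self,
          RingHom.id_apply] }
  refine ⟨g₁, g₂, IsLocalRing.maximalIdeal R, h₁, h₂, hb₁', hb₂', fun b => rfl, fun p => ?_⟩
  change ν (jN (AlgebraicNodeRing.mk κ 0 p)) = _
  exact hν p

include he in
/-- **The extended ideal `𝔫(κ' ⊗_κ B)` is maximal** in the situation of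
`exists_completion_tensor_equiv_nodeQuot` (its residue ring is that of the origin of
`κ'[u,v]/(uv)`, i.e. `κ'`: the point is rational, so exactly one point of the base-changed fibre lies
over it). [cite: DeJong1997, 5.7 and p. 614–615] -/
theorem isMaximal_map_tensorInr_of_completion_equiv : (𝔫.map (tensorInr κ κ' B)).IsMaximal := by
  obtain ⟨g₁, g₂, 𝔪, h₁, h₂, hb₁, hb₂, -, -⟩ := exists_levelBijective_into_nodeQuot 𝔫 e he
  set R := MvPowerSeries (Fin 2) κ ⧸
    Ideal.span {(MvPowerSeries.X 0 * MvPowerSeries.X 1 : MvPowerSeries (Fin 2) κ)} with hR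
  obtain ⟨β, -, hβ₂⟩ := exists_baseChange_algebraicNodeRing_equiv κ κ'
  -- `(ū, v̄)(κ' ⊗ κ[u,v]/(uv))` is maximal
  have hmN : ((nodeOrigin κ).map (tensorInr κ κ' (AlgebraicNodeRing κ (0 : κ)))).IsMaximal := by
    rw [← Ideal.comap_map_of_bijective β.toRingHom β.bijective
      (I := (nodeOrigin κ).map (tensorInr κ κ' (AlgebraicNodeRing κ (0 : κ)))), hβ₂]
    exact Ideal.comap_isMaximal_of_surjective _ β.surjective
  -- hence so is `𝔪(κ' ⊗ R)` (level one of the second base change) ...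
  have hmR : ((𝔪.map (tensorInr κ κ' R)) ^ 1).IsMaximal := by
    let ε := RingEquiv.ofBijective _ (levelBijective_lTensor κ' g₂ _ 𝔪 h₂ hb₂ 1)
    have hf : IsField ((κ' ⊗[κ] AlgebraicNodeRing κ (0 : κ)) ⧸
        ((nodeOrigin κ).map (tensorInr κ κ' (AlgebraicNodeRing κ (0 : κ)))) ^ 1) :=
      (Ideal.Quotient.maximal_ideal_iff_isField_quotient _).mp (by rwa [pow_one])
    exact Ideal.Quotient.maximal_of_isField _ (MulEquiv.isField hf ε.symm.toMulEquiv)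
  -- ... and `𝔫(κ' ⊗ B)` (level one of the first base change)
  let ε₁ := RingEquiv.ofBijective _ (levelBijective_lTensor κ' g₁ 𝔫 𝔪 h₁ hb₁ 1)
  have hf₁ : IsField ((κ' ⊗[κ] B) ⧸ (𝔫.map (tensorInr κ κ' B)) ^ 1) :=
    MulEquiv.isField ((Ideal.Quotient.maximal_ideal_iff_isField_quotient _).mp hmR) ε₁.toMulEquiv
  have := Ideal.Quotient.maximal_of_isField _ hf₁
  rwa [pow_one] at this

end Main

section Entry

open DeJong1996 DeJong1996.AlgebraicNodeRing

/-- **The completed base change of the ordinary double point** (the algebra of "a rational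
singular point with rational tangents stays so under field extension", de Jong 1997, p. 614–615):
if a Noetherian `κ`-algebra `B` has `𝔫`-adic completion `κ⟦u,v⟧/(uv)` at a maximal ideal `𝔫`,
compatibly with `κ`, then `κ' ⊗_κ B` has `𝔫(κ' ⊗_κ B)`-adic completion `κ'⟦u,v⟧/(uv)`,
compatibly with `κ'`. Proof: `B → κ⟦u,v⟧/(uv) ← κ[u,v]/(uv)` are level-bijective over `κ`
(`exists_levelBijective_into_nodeQuot`), hence so are their base changes to `κ'`
(`levelBijective_lTensor`), and `κ' ⊗_κ κ[u,v]/(uv) = κ'[u,v]/(uv)` has completion `κ'⟦u,v⟧/(uv)`.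
[cite: DeJong1997, 5.7 and p. 614–615] -/
theorem exists_completion_tensor_equiv_nodeQuot {κ : Type u} [Field κ] (κ' : Type u) [Field κ']
    [Algebra κ κ'] {B : Type u} [CommRing B] [Algebra κ B] [IsNoetherianRing B] (𝔫 : Ideal B)
    [𝔫.IsMaximal] (e : AdicCompletion 𝔫 B ≃+* MvPowerSeries (Fin 2) κ ⧸
      Ideal.span {(MvPowerSeries.X 0 * MvPowerSeries.X 1 : MvPowerSeries (Fin 2) κ)})
    (he : ∀ c : κ, e (algebraMap κ (AdicCompletion 𝔫 B) c) = algebraMap κ _ c) :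
    ∃ e' : AdicCompletion (𝔫.map (tensorInr κ κ' B)) (TensorProduct κ κ' B) ≃+*
        MvPowerSeries (Fin 2) κ' ⧸
          Ideal.span {(MvPowerSeries.X 0 * MvPowerSeries.X 1 : MvPowerSeries (Fin 2) κ')},
      ∀ c : κ', e' (algebraMap κ' _ c) = algebraMap κ' _ c := by
  obtain ⟨g₁, g₂, 𝔪, h₁, h₂, hb₁, hb₂, hg₁, hg₂⟩ := exists_levelBijective_into_nodeQuot 𝔫 e he
  set R := MvPowerSeries (Fin 2) κ ⧸
    Ideal.span {(MvPowerSeries.X 0 * MvPowerSeries.X 1 : MvPowerSeries (Fin 2) κ)} with hR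
  -- the two level-bijective base changes into `κ' ⊗ R`
  let E₁ : AdicCompletion (𝔫.map (tensorInr κ κ' B)) (κ' ⊗[κ] B) ≃+*
      AdicCompletion (𝔪.map (tensorInr κ κ' R)) (κ' ⊗[κ] R) :=
    adicCompletionEquivOfQuotientMap _ _ (Algebra.TensorProduct.map (AlgHom.id κ' κ') g₁).toRingHom
      (map_map_tensorInr_le κ' g₁ 𝔫 𝔪 h₁) (levelBijective_lTensor κ' g₁ 𝔫 𝔪 h₁ hb₁)
  let E₂ : AdicCompletion ((nodeOrigin κ).map (tensorInr κ κ' (AlgebraicNodeRing κ (0 : κ))))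
      (κ' ⊗[κ] AlgebraicNodeRing κ (0 : κ)) ≃+* AdicCompletion (𝔪.map (tensorInr κ κ' R)) (κ' ⊗[κ] R) :=
    adicCompletionEquivOfQuotientMap _ _ (Algebra.TensorProduct.map (AlgHom.id κ' κ') g₂).toRingHom
      (map_map_tensorInr_le κ' g₂ _ 𝔪 h₂) (levelBijective_lTensor κ' g₂ _ 𝔪 h₂ hb₂)
  -- `κ' ⊗ κ[u,v]/(uv) ≅ κ'[u,v]/(uv)` and its completion
  obtain ⟨β, hβ₁, hβ₂⟩ := exists_baseChange_algebraicNodeRing_equiv κ κ'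
  let E₃ : AdicCompletion ((nodeOrigin κ).map (tensorInr κ κ' (AlgebraicNodeRing κ (0 : κ))))
      (κ' ⊗[κ] AlgebraicNodeRing κ (0 : κ)) ≃+* AdicCompletion (nodeOrigin κ') (AlgebraicNodeRing κ' (0 : κ')) :=
    adicCompletionCongr _ _ β hβ₂
  obtain ⟨ν', hν'⟩ := exists_completion_algebraicNodeRing_equiv κ'
  refine ⟨(E₁.trans E₂.symm).trans (E₃.trans ν'), fun c => ?_⟩
  have hc : algebraMap κ' (AdicCompletion (𝔫.map (tensorInr κ κ' B)) (κ' ⊗[κ] B)) c =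
      of _ _ (c ⊗ₜ[κ] (1 : B)) := by
    rw [AdicCompletion.algebraMap_apply, Algebra.TensorProduct.algebraMap_apply, Algebra.algebraMap_self,
      RingHom.id_apply]
  have h1 : E₁ (of _ _ (c ⊗ₜ[κ] (1 : B))) = of _ _ (c ⊗ₜ[κ] (1 : R)) := by
    simp only [E₁]
    rw [adicCompletionEquivOfQuotientMap_of, AlgHom.toRingHom_eq_coe, RingHom.coe_coe,
      Algebra.TensorProduct.map_tmul, AlgHom.coe_id, id_eq, map_one]
  have h2 : E₂.symm (of _ _ (c ⊗ₜ[κ] (1 : R))) = of _ _ (c ⊗ₜ[κ] (1 : AlgebraicNodeRing κ (0 : κ))) := by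
    rw [RingEquiv.symm_apply_eq]
    simp only [E₂]
    rw [adicCompletionEquivOfQuotientMap_of, AlgHom.toRingHom_eq_coe, RingHom.coe_coe,
      Algebra.TensorProduct.map_tmul, AlgHom.coe_id, id_eq, map_one]
  have h3 : E₃ (of _ _ (c ⊗ₜ[κ] (1 : AlgebraicNodeRing κ (0 : κ)))) = of _ _ (algebraMap κ' _ c) := by
    simp only [E₃]
    rw [adicCompletionCongr_of, hβ₁]
  have h4 : ν' (of _ _ (algebraMap κ' (AlgebraicNodeRing κ' (0 : κ')) c)) = algebraMap κ' _ c := by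
    rw [AlgebraicNodeRing.algebraMap_eq, ← AlgebraicNodeRing.mk_apply, hν', MvPolynomial.coe_C,
      ← Ideal.Quotient.mk_algebraMap, MvPowerSeries.algebraMap_apply, Algebra.algebraMap_self, RingHom.id_apply]
  rw [hc]
  simp only [RingEquiv.trans_apply]
  rw [h1, h2, h3, h4]

end Entry


end Summit.ResolutionOfSingularities.ResolutionOfSingularities.Theorems

end
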